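import Summits.QuantumFields.YangMills.Theorems.FluctuationComparisonRegPrIntLS2BetaSlowShellConeCentre
import HarnessLib

/-!
# S2β · D-GUARD ∕ (BG∞) — (B3-S)′ A CONE CENTRE FOR A SLOW BOX SHELL: the box edition of ✓p840379 `…SlowShellConeCentre` — data on the boundary shell of
# `{0..n₁} × {0..n₂} × {0..n₃}` (`n₂, n₃ ≤ n₁`) with per-bond oscillation `≤ δ` along the three forward families admit a centre `a` with the whole shell in the
# cap `π − r`, once `(π∕2)·2(m−1)·δ ≤ r∕2` and `6(n₁∕m+1)²·(2∕(3π))(3r∕2)³ < 1` (the six face nets of ✓p840086 re-indexed in the largest face's index type,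
# so the count is the cube's); plus the reader in (L-S)′ `…SqrtGaugeStageSBoxBlock` currency delivering its `hcap` from its `hstep`

Cell `ym3-torus` (YM ladder rung R3 = continuum `SU(2)` Yang–Mills on the three-torus at fixed lattice data — a RUNG: NOT d = 4, NOT infinite volume,
NOT a mass gap, NOT Clay).  Width seat «width 8» `ym3-torus-px8` (gen 28, toron∕flux lineage ✓p826411 → px17 (W1) ✓p837971), FREE px helper on crux
`stmt-QuantumFields-20520`; `--kind proof --supports stmt-QuantumFields-20520 --as helper`, count-neutral, DEFINITION-FREE (0 `def`, 0 `instance`, 0 `notation`,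
0 `sorry`, default heartbeats).  Brick 3∕4 of the S-lane box road for px19 g25's filling letter `h₃` (STATUS 2026-09-01T02:57:13Z plan; 02:58:38Z «agreed»).

WHY.  `h₃`'s slow-shell premise bounds the datum's bonds with both ends on the BOX shell; (L-S)′'s laws need a centre `a` with the box's shell data inside the
cap `π − r` (its `hcap`).  As in ✓p840379: the six faces are grids (`n₂ × n₃`, `n₁ × n₃`, `n₁ × n₂`) with per-bond oscillation `δ`; ✓`exists_patch_of_grid`
subsamples each every `m` steps; injecting the face index types into `Fin (n₁∕m+1)²` (`Fin.castLE`, `n₂, n₃ ≤ n₁`) keeps ONE index type of cardinality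
`6(n₁∕m+1)²` for ✓`exists_coneCentre_of_patched` — so the numeric side conditions are those of the cubic edition verbatim (the next file discharges them).

WHAT IS PROVED (sorry-free; def-free).
* §1 `exists_patch_of_grid_castLE` (a face net re-indexed in the largest index type), ★★★ `exists_boxShellCentre (n₁ n₂ n₃ m) (h₂₁ h₃₁) (hm) (ψ) (hδ hr0 hrπ)
  (h1 h2 h3 : the three forward box-shell letters ≤ δ — the letters of ✓∕⧗`exists_coneOnBox` (iii′)) (hrad) (hcard) : ∃ a, ∀ i k l in the box, shell →
  ‖logVec (su2Quat (a⁻¹ * ψ (i, k, l)))‖ ≤ π − r` — conclusion = `exists_coneOnBox`'s shell cap VERBATIM.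
* §2 ★★★ `exists_boxCentre (φ) (hαβ hαγ hβγ) (t) (n₁ n₂ n₃ m) … (hstep : (L-S)′'s per-bond shell letter with `δ`) (hrad) (hcard) : ∃ a, ⟨(L-S)′'s hcap⟩` VERBATIM
  (via ✓`eq_uuu_of_mem_cube` and ✓p840187's cube-point algebra).

HONEST SCOPE.  Composition of landed metric bookkeeping (✓p840086, ✓p839220, ✓p840379, ✓p840187); the numeric side conditions are the consumer's; no gauge field;
nothing of Bałaban's renormalisation-group analysis is asserted or proved ([Balaban1985RegularSpaces] Thm 2 p.83 — local small gauges — is the consumer's context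
only).  `h₃` ∕ `hSec` ∕ (BG∞) ∕ `hBG` are HYPOTHESES∕CONJECTURES and NOT proved; GAP♯∘ (registry v11 UNTOUCHED), the five registered stubs (0∕5), S2β, 20520, 19936,
19200, `YM3TorusSU2` are NOT proved; no registered stub is closed; rung R3 — NOT d = 4, NOT infinite volume, NOT a mass gap, NOT Clay; the Yang–Mills mass gap is
NOT proved.  Axioms standard.

References: T. Bałaban, CMP **99** (1985) 75–102 [Balaban1985RegularSpaces] (Thm 2 p.83).
-/

set_option autoImplicit false

noncomputable section

namespace Summit.QuantumFields.YangMills.Theorems.FluctuationComparisonRegPrIntLS2BetaSlowBoxShellConeCentre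

open scoped Real
open Literature.MathematicalPhysics.QuantumLattice (su2Quat)
open Literature.MathematicalPhysics.QuantumFieldTheory.Balaban1983to89
open T4CubeChartGnomonic (SU2)
open T4ExpWindowSmallField (logVec)
open Summit.QuantumFields.YangMills.Theorems.FluctuationComparisonRegPrIntLS2BetaSlowDataNets (exists_patch_of_grid)
open Summit.QuantumFields.YangMills.Theorems.FluctuationComparisonRegPrIntLS2BetaAntipodalConeCentre (exists_coneCentre_of_patched)
open Summit.QuantumFields.YangMills.Theorems.FluctuationComparisonRegPrIntLS2BetaSlowShellConeCentre (card_faces eq_uuu_of_mem_cube)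
open Summit.QuantumFields.YangMills.Theorems.FluctuationComparisonRegPrIntLS2BetaCubeOffsetAlgebra

/-! ## §1 The centre of a slow box shell -/

/-- A face net of a smaller grid re-indexed in the largest face index type: the patch of ✓`exists_patch_of_grid` on an `n' × n''` face, `n', n'' ≤ n₁`, with its
index injected into `Fin (n₁∕m+1) × Fin (n₁∕m+1)`. [folklore] -/
theorem exists_patch_of_grid_castLE (ψ : ℕ → ℕ → SU2) (n' n'' n₁ : ℕ) (h' : n' ≤ n₁) (h'' : n'' ≤ n₁) {δ : ℝ} (hδ : 0 ≤ δ)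
    (hH : ∀ i k, i + 1 ≤ n' → k ≤ n'' → dist1 (ψ i k * (ψ (i + 1) k)⁻¹) ≤ δ)
    (hV : ∀ i k, i ≤ n' → k + 1 ≤ n'' → dist1 (ψ i k * (ψ i (k + 1))⁻¹) ≤ δ)
    (m : ℕ) (hm : 1 ≤ m) :
    ∀ p : Fin (n' + 1) × Fin (n'' + 1), ∃ q : Fin (n₁ / m + 1) × Fin (n₁ / m + 1),
      ‖logVec (su2Quat ((ψ (m * (q.1 : ℕ)) (m * (q.2 : ℕ)))⁻¹ * ψ (p.1 : ℕ) (p.2 : ℕ)))‖ ≤ π / 2 * (((2 * (m - 1) : ℕ) : ℝ) * δ) := by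
  intro p
  obtain ⟨q, hq⟩ := exists_patch_of_grid ψ n' n'' hδ hH hV m hm p
  exact ⟨(Fin.castLE (Nat.succ_le_succ (Nat.div_le_div_right h')) q.1, Fin.castLE (Nat.succ_le_succ (Nat.div_le_div_right h'')) q.2),
    by simpa using hq⟩

/-- ★★★ **A CONE CENTRE FOR A SLOW BOX SHELL**: data `ψ` on the boundary shell of `{0..n₁} × {0..n₂} × {0..n₃}` (`n₂, n₃ ≤ n₁`) with per-bond oscillation
`dist1 ≤ δ` along the three families of forward shell steps, a subsampling step `m ≥ 1` with `(π∕2)·2(m−1)·δ ≤ r∕2`, and the packing count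
`6(n₁∕m+1)²·(2∕(3π))(3r∕2)³ < 1` admit a centre `a` with every shell datum inside the cap `‖logVec (a⁻¹·ψ (i,k,l))‖ ≤ π − r` — the shell-cap hypothesis of
✓∕⧗`exists_coneOnBox` ∕ (L-S)′. [cite: Balaban1985RegularSpaces, Thm 2 p.83] -/
theorem exists_boxShellCentre (n₁ n₂ n₃ m : ℕ) (h₂₁ : n₂ ≤ n₁) (h₃₁ : n₃ ≤ n₁) (hm : 1 ≤ m) (ψ : ℕ × ℕ × ℕ → SU2) {δ r : ℝ} (hδ : 0 ≤ δ)
    (hr0 : 0 ≤ r) (hrπ : 3 * r / 2 ≤ π)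
    (h1 : ∀ i k l, i + 1 ≤ n₁ → k ≤ n₂ → l ≤ n₃ → (i = 0 ∨ i = n₁ ∨ k = 0 ∨ k = n₂ ∨ l = 0 ∨ l = n₃) →
      (i + 1 = n₁ ∨ k = 0 ∨ k = n₂ ∨ l = 0 ∨ l = n₃) → dist1 (ψ (i, k, l) * (ψ (i + 1, k, l))⁻¹) ≤ δ)
    (h2 : ∀ i k l, i ≤ n₁ → k + 1 ≤ n₂ → l ≤ n₃ → (i = 0 ∨ i = n₁ ∨ k = 0 ∨ k = n₂ ∨ l = 0 ∨ l = n₃) →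
      (i = 0 ∨ i = n₁ ∨ k + 1 = n₂ ∨ l = 0 ∨ l = n₃) → dist1 (ψ (i, k, l) * (ψ (i, k + 1, l))⁻¹) ≤ δ)
    (h3 : ∀ i k l, i ≤ n₁ → k ≤ n₂ → l + 1 ≤ n₃ → (i = 0 ∨ i = n₁ ∨ k = 0 ∨ k = n₂ ∨ l = 0 ∨ l = n₃) →
      (i = 0 ∨ i = n₁ ∨ k = 0 ∨ k = n₂ ∨ l + 1 = n₃) → dist1 (ψ (i, k, l) * (ψ (i, k, l + 1))⁻¹) ≤ δ)
    (hrad : π / 2 * (((2 * (m - 1) : ℕ) : ℝ) * δ) ≤ r / 2)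
    (hcard : ((6 * ((n₁ / m + 1) * (n₁ / m + 1)) : ℕ) : ℝ) * (2 / (3 * π) * (3 * r / 2) ^ 3) < 1) :
    ∃ a : SU2, ∀ i k l, i ≤ n₁ → k ≤ n₂ → l ≤ n₃ → (i = 0 ∨ i = n₁ ∨ k = 0 ∨ k = n₂ ∨ l = 0 ∨ l = n₃) →
      ‖logVec (su2Quat (a⁻¹ * ψ (i, k, l)))‖ ≤ π - r := by
  -- the six faces as slow grids, subsampled every `m` steps, indexed in `Fin (n₁∕m+1)²`
  have hF1 := exists_patch_of_grid_castLE (fun k l => ψ (0, k, l)) n₂ n₃ n₁ h₂₁ h₃₁ hδ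
    (fun k l hk hl => h2 0 k l (Nat.zero_le _) hk hl (Or.inl rfl) (Or.inl rfl))
    (fun k l hk hl => h3 0 k l (Nat.zero_le _) hk hl (Or.inl rfl) (Or.inl rfl)) m hm
  have hF2 := exists_patch_of_grid_castLE (fun k l => ψ (n₁, k, l)) n₂ n₃ n₁ h₂₁ h₃₁ hδ
    (fun k l hk hl => h2 n₁ k l le_rfl hk hl (Or.inr (Or.inl rfl)) (Or.inr (Or.inl rfl)))
    (fun k l hk hl => h3 n₁ k l le_rfl hk hl (Or.inr (Or.inl rfl)) (Or.inr (Or.inl rfl))) m hm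
  have hF3 := exists_patch_of_grid_castLE (fun i l => ψ (i, 0, l)) n₁ n₃ n₁ le_rfl h₃₁ hδ
    (fun i l hi hl => h1 i 0 l hi (Nat.zero_le _) hl (Or.inr (Or.inr (Or.inl rfl))) (Or.inr (Or.inl rfl)))
    (fun i l hi hl => h3 i 0 l hi (Nat.zero_le _) hl (Or.inr (Or.inr (Or.inl rfl))) (Or.inr (Or.inr (Or.inl rfl)))) m hm
  have hF4 := exists_patch_of_grid_castLE (fun i l => ψ (i, n₂, l)) n₁ n₃ n₁ le_rfl h₃₁ hδ
    (fun i l hi hl => h1 i n₂ l hi le_rfl hl (Or.inr (Or.inr (Or.inr (Or.inl rfl)))) (Or.inr (Or.inr (Or.inl rfl))))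
    (fun i l hi hl => h3 i n₂ l hi le_rfl hl (Or.inr (Or.inr (Or.inr (Or.inl rfl)))) (Or.inr (Or.inr (Or.inr (Or.inl rfl))))) m hm
  have hF5 := exists_patch_of_grid_castLE (fun i k => ψ (i, k, 0)) n₁ n₂ n₁ le_rfl h₂₁ hδ
    (fun i k hi hk => h1 i k 0 hi hk (Nat.zero_le _) (Or.inr (Or.inr (Or.inr (Or.inr (Or.inl rfl))))) (Or.inr (Or.inr (Or.inr (Or.inl rfl)))))
    (fun i k hi hk => h2 i k 0 hi hk (Nat.zero_le _) (Or.inr (Or.inr (Or.inr (Or.inr (Or.inl rfl))))) (Or.inr (Or.inr (Or.inr (Or.inl rfl))))) m hm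
  have hF6 := exists_patch_of_grid_castLE (fun i k => ψ (i, k, n₃)) n₁ n₂ n₁ le_rfl h₂₁ hδ
    (fun i k hi hk => h1 i k n₃ hi hk le_rfl (Or.inr (Or.inr (Or.inr (Or.inr (Or.inr rfl))))) (Or.inr (Or.inr (Or.inr (Or.inr rfl)))))
    (fun i k hi hk => h2 i k n₃ hi hk le_rfl (Or.inr (Or.inr (Or.inr (Or.inr (Or.inr rfl))))) (Or.inr (Or.inr (Or.inr (Or.inr rfl))))) m hm
  obtain ⟨a, ha⟩ := exists_coneCentre_of_patched
    (ι := (((Fin (n₁ / m + 1) × Fin (n₁ / m + 1)) ⊕ (Fin (n₁ / m + 1) × Fin (n₁ / m + 1))) ⊕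
      ((Fin (n₁ / m + 1) × Fin (n₁ / m + 1)) ⊕ (Fin (n₁ / m + 1) × Fin (n₁ / m + 1)))) ⊕
      ((Fin (n₁ / m + 1) × Fin (n₁ / m + 1)) ⊕ (Fin (n₁ / m + 1) × Fin (n₁ / m + 1))))
    (Sum.elim
      (Sum.elim
        (Sum.elim (fun q => ψ (0, m * (q.1 : ℕ), m * (q.2 : ℕ))) (fun q => ψ (n₁, m * (q.1 : ℕ), m * (q.2 : ℕ))))
        (Sum.elim (fun q => ψ (m * (q.1 : ℕ), 0, m * (q.2 : ℕ))) (fun q => ψ (m * (q.1 : ℕ), n₂, m * (q.2 : ℕ)))))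
      (Sum.elim (fun q => ψ (m * (q.1 : ℕ), m * (q.2 : ℕ), 0)) (fun q => ψ (m * (q.1 : ℕ), m * (q.2 : ℕ), n₃))))
    (Sum.elim
      (Sum.elim
        (Sum.elim (fun p : Fin (n₂ + 1) × Fin (n₃ + 1) => ψ (0, (p.1 : ℕ), (p.2 : ℕ)))
          (fun p : Fin (n₂ + 1) × Fin (n₃ + 1) => ψ (n₁, (p.1 : ℕ), (p.2 : ℕ))))
        (Sum.elim (fun p : Fin (n₁ + 1) × Fin (n₃ + 1) => ψ ((p.1 : ℕ), 0, (p.2 : ℕ)))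
          (fun p : Fin (n₁ + 1) × Fin (n₃ + 1) => ψ ((p.1 : ℕ), n₂, (p.2 : ℕ)))))
      (Sum.elim (fun p : Fin (n₁ + 1) × Fin (n₂ + 1) => ψ ((p.1 : ℕ), (p.2 : ℕ), 0))
        (fun p : Fin (n₁ + 1) × Fin (n₂ + 1) => ψ ((p.1 : ℕ), (p.2 : ℕ), n₃))))
    hr0 hrπ
    (by
      rintro (((p | p) | (p | p)) | (p | p))
      · obtain ⟨q, hq⟩ := hF1 p
        exact ⟨Sum.inl (Sum.inl (Sum.inl q)), by simpa using hq.trans hrad⟩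
      · obtain ⟨q, hq⟩ := hF2 p
        exact ⟨Sum.inl (Sum.inl (Sum.inr q)), by simpa using hq.trans hrad⟩
      · obtain ⟨q, hq⟩ := hF3 p
        exact ⟨Sum.inl (Sum.inr (Sum.inl q)), by simpa using hq.trans hrad⟩
      · obtain ⟨q, hq⟩ := hF4 p
        exact ⟨Sum.inl (Sum.inr (Sum.inr q)), by simpa using hq.trans hrad⟩
      · obtain ⟨q, hq⟩ := hF5 p
        exact ⟨Sum.inr (Sum.inl q), by simpa using hq.trans hrad⟩
      · obtain ⟨q, hq⟩ := hF6 p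
        exact ⟨Sum.inr (Sum.inr q), by simpa using hq.trans hrad⟩)
    (by rw [card_faces]; exact hcard)
  refine ⟨a, fun i k l hi hk hl hb => ?_⟩
  rcases hb with h | h | h | h | h | h
  · have ha1 := ha (Sum.inl (Sum.inl (Sum.inl (⟨k, Nat.lt_succ_of_le hk⟩, ⟨l, Nat.lt_succ_of_le hl⟩))))
    rw [h]; simpa using ha1
  · have ha1 := ha (Sum.inl (Sum.inl (Sum.inr (⟨k, Nat.lt_succ_of_le hk⟩, ⟨l, Nat.lt_succ_of_le hl⟩))))
    rw [h]; simpa using ha1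
  · have ha1 := ha (Sum.inl (Sum.inr (Sum.inl (⟨i, Nat.lt_succ_of_le hi⟩, ⟨l, Nat.lt_succ_of_le hl⟩))))
    rw [h]; simpa using ha1
  · have ha1 := ha (Sum.inl (Sum.inr (Sum.inr (⟨i, Nat.lt_succ_of_le hi⟩, ⟨l, Nat.lt_succ_of_le hl⟩))))
    rw [h]; simpa using ha1
  · have ha1 := ha (Sum.inr (Sum.inl (⟨i, Nat.lt_succ_of_le hi⟩, ⟨k, Nat.lt_succ_of_le hk⟩)))
    rw [h]; simpa using ha1
  · have ha1 := ha (Sum.inr (Sum.inr (⟨i, Nat.lt_succ_of_le hi⟩, ⟨k, Nat.lt_succ_of_le hk⟩)))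
    rw [h]; simpa using ha1

/-! ## §2 The centre read through the box of an offset vector ((L-S)′ currency) -/

variable {P : Params}

/-- ★★★ **A CONE CENTRE FOR THE BOX OF AN OFFSET VECTOR** ((L-S)′ currency): for pairwise distinct axes `α, β, γ`, an offset vector `t`, sides `n₂, n₃ ≤ n₁`, a
subsampling step `m ≥ 1` and the two numeric side conditions, (L-S)′'s per-bond shell letter `hstep` (with `δ`) yields a centre `a` satisfying (L-S)′'s shell-cap
hypothesis `hcap` VERBATIM. [cite: Balaban1985RegularSpaces, Thm 2 p.83] -/
theorem exists_boxCentre (φ : (Fin P.d → ℕ) → SU2) {α β γ : Fin P.d} (hαβ : α ≠ β) (hαγ : α ≠ γ) (hβγ : β ≠ γ) (t : Fin P.d → ℕ)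
    (n₁ n₂ n₃ m : ℕ) (h₂₁ : n₂ ≤ n₁) (h₃₁ : n₃ ≤ n₁) (hm : 1 ≤ m) {δ r : ℝ} (hδ : 0 ≤ δ) (hr0 : 0 ≤ r) (hrπ : 3 * r / 2 ≤ π)
    (hstep : ∀ u : Fin P.d → ℕ, ∀ κ : Fin P.d, (κ = α ∨ κ = β ∨ κ = γ) →
      Function.update (Function.update (Function.update u α (t α)) β (t β)) γ (t γ) = t →
      u α ≤ n₁ → u β ≤ n₂ → u γ ≤ n₃ → (u α = 0 ∨ u α = n₁ ∨ u β = 0 ∨ u β = n₂ ∨ u γ = 0 ∨ u γ = n₃) →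
      Function.update u κ (u κ + 1) α ≤ n₁ → Function.update u κ (u κ + 1) β ≤ n₂ → Function.update u κ (u κ + 1) γ ≤ n₃ →
      (Function.update u κ (u κ + 1) α = 0 ∨ Function.update u κ (u κ + 1) α = n₁ ∨
        Function.update u κ (u κ + 1) β = 0 ∨ Function.update u κ (u κ + 1) β = n₂ ∨
        Function.update u κ (u κ + 1) γ = 0 ∨ Function.update u κ (u κ + 1) γ = n₃) →
      dist1 (φ u * (φ (Function.update u κ (u κ + 1)))⁻¹) ≤ δ)
    (hrad : π / 2 * (((2 * (m - 1) : ℕ) : ℝ) * δ) ≤ r / 2)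
    (hcard : ((6 * ((n₁ / m + 1) * (n₁ / m + 1)) : ℕ) : ℝ) * (2 / (3 * π) * (3 * r / 2) ^ 3) < 1) :
    ∃ a : SU2, ∀ u : Fin P.d → ℕ, Function.update (Function.update (Function.update u α (t α)) β (t β)) γ (t γ) = t →
      u α ≤ n₁ → u β ≤ n₂ → u γ ≤ n₃ → (u α = 0 ∨ u α = n₁ ∨ u β = 0 ∨ u β = n₂ ∨ u γ = 0 ∨ u γ = n₃) →
      ‖logVec (su2Quat (a⁻¹ * φ u))‖ ≤ π - r := by
  obtain ⟨a, ha⟩ := exists_boxShellCentre n₁ n₂ n₃ m h₂₁ h₃₁ hm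
    (fun p : ℕ × ℕ × ℕ => φ (Function.update (Function.update (Function.update t α p.1) β p.2.1) γ p.2.2)) hδ hr0 hrπ
    (fun i k l hi hk hl hb hb' => by
      have h := hstep (Function.update (Function.update (Function.update t α i) β k) γ l) α (Or.inl rfl) (uuu_mem_cube t hαβ hαγ hβγ i k l)
      rw [uuu_step_fst t hαβ hαγ, uuu_apply_fst t hαβ hαγ, uuu_apply_snd t α hβγ, uuu_apply_thd,
        uuu_apply_fst t hαβ hαγ, uuu_apply_snd t α hβγ, uuu_apply_thd] at h
      exact h (by omega) hk hl hb hi hk hl (by omega))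
    (fun i k l hi hk hl hb hb' => by
      have h := hstep (Function.update (Function.update (Function.update t α i) β k) γ l) β (Or.inr (Or.inl rfl))
        (uuu_mem_cube t hαβ hαγ hβγ i k l)
      rw [uuu_step_snd t α hβγ, uuu_apply_fst t hαβ hαγ, uuu_apply_snd t α hβγ, uuu_apply_thd,
        uuu_apply_fst t hαβ hαγ, uuu_apply_snd t α hβγ, uuu_apply_thd] at h
      exact h hi (by omega) hl hb hi hk hl (by omega))
    (fun i k l hi hk hl hb hb' => by
      have h := hstep (Function.update (Function.update (Function.update t α i) β k) γ l) γ (Or.inr (Or.inr rfl))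
        (uuu_mem_cube t hαβ hαγ hβγ i k l)
      rw [uuu_step_thd t α β γ, uuu_apply_fst t hαβ hαγ, uuu_apply_snd t α hβγ, uuu_apply_thd,
        uuu_apply_fst t hαβ hαγ, uuu_apply_snd t α hβγ, uuu_apply_thd] at h
      exact h hi hk (by omega) hb hi hk hl (by omega))
    hrad hcard
  refine ⟨a, fun u hu hα hβ hγ hb => ?_⟩
  have h := ha (u α) (u β) (u γ) hα hβ hγ hb
  rw [← eq_uuu_of_mem_cube t u α β γ hu] at h
  exact h

end Summit.QuantumFields.YangMills.Theorems.FluctuationComparisonRegPrIntLS2BetaSlowBoxShellConeCentre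

end
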